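import Summits.MatrixMultiplication.MatrixMultiplication.Theses.StabilizerTensorRank
import Summits.MatrixMultiplication.MatrixMultiplication.Theorems.StabilizerTensorRankStabKronecker
import Literature.Computability.QuantumComplexity.StabilizerSimulationGadgetProofs

/-!
# `StrassenPowerFrame` — `χ₃(⟨2^k, 2^k, 2^k⟩) ≤ 7^k` (route StabilizerTensorRank, item 3834)

Route `MatrixMultiplication/StabilizerTensorRank`, item `stmt-MatrixMultiplication-3834`
(`StrassenPowerFrame`, support): for every `k`, the matrix multiplication tensor
`⟨2^k, 2^k, 2^k⟩` has a STABILIZER SCHEME with `7^k` terms — a decomposition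
`∑_{i < 7^k} cᵢ · wᵢ ⊗ uᵢ ⊗ vᵢ` all of whose legs, read as `2k`-qubit vectors (row bits, then
column bits), are stabilizer states (`Literature.Computability.AlgebraicComplexity.HasStabilizerScheme`,
verbatim the inline block of the item, `hasStabilizerScheme_iff`).

Proof (Strassen 1969 + Kronecker closure of the stabilizer model):

* the tensor is read at the bit level (`matMulTensor_bitSplitEquiv`: after `bitSplitEquiv` the
  entry of `⟨2^k⟩` is the indicator of three bitwise equalities), and a bit-level scheme (legs
  `QReg (k + k) → ℂ`) is transported to the item's legs `Fin (2^k) × Fin (2^k) → ℂ`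
  (`hasStabilizerScheme_of_bits`);
* STRASSEN (`hasStabilizerScheme_one`): the seven products give `⟨2,2,2⟩` as a sum of seven
  triads whose `21` legs are `|x⟩` or `|x⟩ ± |y⟩` (`x ≠ y ∈ 𝔽₂²`), each a scalar multiple of a
  `2`-qubit stabilizer state (`|x⟩ + i^m X^{x ⊕ y}|x⟩`, the tree's Pauli-projection rule
  `StabilizerFormalism.exists_smul_stabilizer_of_pauliProj`, Aaronson–Gottesman 2004 §III); the
  scalars are absorbed into the coefficients (`hasStabilizerScheme_of_scaled`);
* KRONECKER: the tree's `hasStabilizerScheme_mul` (Theorems/StabilizerTensorRankStabKronecker,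
  the route's item `StabKronecker`): schemes for `k` and `l` multiply to one for `k + l` with
  `r · s` terms;
* induction on `k` from the standard one-term scheme at `k = 0` (`hasStabilizerScheme_standard`).

No definitions and no named facts are introduced. The helpers live in the sub-namespace
`StrassenPowerFrame`; the closing theorem is `strassenPowerFrame_proof`.

References: V. Strassen, *Gaussian elimination is not optimal*, Numer. Math. 13 (1969) 354–356;
M. Bläser, *Fast Matrix Multiplication*, Theory of Computing Library, Graduate Surveys 5 (2013),
§5 (Kronecker products of bilinear algorithms, `R(⟨nm⟩) ≤ R(⟨n⟩) R(⟨m⟩)`); S. Aaronson,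
D. Gottesman, Phys. Rev. A 70 (2004) 052328, §III.
-/

-- the summit namespace `Summit.MatrixMultiplication.MatrixMultiplication.Theorems` is prescribed (D-0017)
set_option linter.dupNamespace false

noncomputable section

open scoped BigOperators

namespace Summit.MatrixMultiplication.MatrixMultiplication.Theorems

open Literature.Computability.AlgebraicComplexity Literature.Computability.QuantumComplexity
  Literature.Computability.Cryptography Matrix

namespace StrassenPowerFrame

/-! ### The matrix multiplication tensor at the bit level -/

/-- After bit-splitting, the entry of `⟨2^k, 2^k, 2^k⟩` at `(x, y, z)` is the indicator of
"row bits of `x` = row bits of `y`, column bits of `y` = row bits of `z`, column bits of `x` =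
column bits of `z`" (Bläser 2013, §5: `⟨k,m,n⟩_{(κν)(κ'μ)(μ'ν')} = [κ=κ'][μ=μ'][ν=ν']`). -/
theorem matMulTensor_bitSplitEquiv (k : ℕ) (x y z : QReg (k + k)) :
    matMulTensor ℂ (2 ^ k) (2 ^ k) (2 ^ k) (bitSplitEquiv k x) (bitSplitEquiv k y)
        (bitSplitEquiv k z) =
      if (∀ j : Fin k, x (Fin.castAdd k j) = y (Fin.castAdd k j)) ∧
          (∀ j : Fin k, y (Fin.natAdd k j) = z (Fin.castAdd k j)) ∧
          (∀ j : Fin k, x (Fin.natAdd k j) = z (Fin.natAdd k j)) then 1 else 0 := by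
  simp only [matMulTensor, bitSplitEquiv, Equiv.coe_fn_mk, EmbeddingLike.apply_eq_iff_eq,
    funext_iff]

/-! ### From bit-level legs to the item's legs -/

/-- From a bit-level stabilizer scheme (legs `QReg (k + k) → ℂ`, any finite index type) to the
item's `HasStabilizerScheme k |σ|` (legs `Fin (2^k) × Fin (2^k) → ℂ`, precomposed with
`(bitSplitEquiv k)⁻¹`). -/
theorem hasStabilizerScheme_of_bits {k : ℕ} {σ : Type*} [Fintype σ] (c : σ → ℂ)
    (ψ φ θ : σ → QReg (k + k) → ℂ) (hψ : ∀ s, ψ s ∈ stabilizerStates (k + k))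
    (hφ : ∀ s, φ s ∈ stabilizerStates (k + k)) (hθ : ∀ s, θ s ∈ stabilizerStates (k + k))
    (h : (fun x y z : QReg (k + k) => matMulTensor ℂ (2 ^ k) (2 ^ k) (2 ^ k) (bitSplitEquiv k x)
        (bitSplitEquiv k y) (bitSplitEquiv k z)) = ∑ s, c s • triad (ψ s) (φ s) (θ s)) :
    HasStabilizerScheme k (Fintype.card σ) := by
  have hleg : ∀ (f : QReg (k + k) → ℂ), legBits k (f ∘ (bitSplitEquiv k).symm) = f := fun f => by
    rw [legBits_eq_comp, Function.comp_assoc, Equiv.symm_comp_self, Function.comp_id]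
  refine hasStabilizerScheme_of_fintype c (fun s => ψ s ∘ (bitSplitEquiv k).symm)
    (fun s => φ s ∘ (bitSplitEquiv k).symm) (fun s => θ s ∘ (bitSplitEquiv k).symm)
    (fun s => ⟨?_, ?_, ?_⟩) ?_
  · rw [hleg]; exact hψ s
  · rw [hleg]; exact hφ s
  · rw [hleg]; exact hθ s
  · funext a b d
    have e := congrFun (congrFun (congrFun h ((bitSplitEquiv k).symm a))
      ((bitSplitEquiv k).symm b)) ((bitSplitEquiv k).symm d)
    simp only [Equiv.apply_symm_apply] at e
    rw [e]
    simp only [Finset.sum_apply, Pi.smul_apply, triad_apply, Function.comp_apply, smul_eq_mul]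

/-! ### Scaled stabilizer legs -/

/-- A bit-level decomposition of `⟨2^k⟩` into `|σ|` triads whose legs are SCALAR MULTIPLES of
stabilizer states is a stabilizer scheme with `|σ|` terms (absorb the scalars into the
coefficients). -/
theorem hasStabilizerScheme_of_scaled {k : ℕ} {σ : Type*} [Fintype σ]
    (W U V : σ → QReg (k + k) → ℂ)
    (hW : ∀ s, ∃ (c : ℂ) (Ψ : QReg (k + k) → ℂ), Ψ ∈ stabilizerStates (k + k) ∧ W s = c • Ψ)
    (hU : ∀ s, ∃ (c : ℂ) (Ψ : QReg (k + k) → ℂ), Ψ ∈ stabilizerStates (k + k) ∧ U s = c • Ψ)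
    (hV : ∀ s, ∃ (c : ℂ) (Ψ : QReg (k + k) → ℂ), Ψ ∈ stabilizerStates (k + k) ∧ V s = c • Ψ)
    (h : (fun x y z : QReg (k + k) => matMulTensor ℂ (2 ^ k) (2 ^ k) (2 ^ k) (bitSplitEquiv k x)
        (bitSplitEquiv k y) (bitSplitEquiv k z)) = ∑ s, triad (W s) (U s) (V s)) :
    HasStabilizerScheme k (Fintype.card σ) := by
  choose cW Ψ hΨ eW using hW
  choose cU Φ hΦ eU using hU
  choose cV Θ hΘ eV using hV
  refine hasStabilizerScheme_of_bits (fun s => cW s * cU s * cV s) Ψ Φ Θ hΨ hΦ hΘ (h.trans ?_)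
  refine Finset.sum_congr rfl fun s _ => ?_
  rw [eW, eU, eV]
  funext x y z
  simp only [triad_apply, Pi.smul_apply, smul_eq_mul]
  ring

/-- A computational basis state is (trivially) a scalar multiple of a stabilizer state.
[Aaronson–Gottesman 2004, §I] -/
theorem exists_smul_stabilizer_basisState {n : ℕ} (x : QReg n) :
    ∃ (c : ℂ) (Ψ : QReg n → ℂ), Ψ ∈ stabilizerStates n ∧ basisState x = c • Ψ :=
  ⟨1, basisState x, basisState_mem_stabilizerStates x, (one_smul _ _).symm⟩

/-- `|x⟩ + i^m |y⟩` is a scalar multiple of a stabilizer state: it is `|x⟩ + (i^m X^{x ⊕ y}) |x⟩`,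
and Pauli projections preserve stabilizer states up to scale (the tree's operational
Gottesman–Knill measurement rule). [Aaronson–Gottesman 2004, §III] -/
theorem exists_smul_stabilizer_basisState_add {n : ℕ} (x y : QReg n) (m : ℕ) :
    ∃ (c : ℂ) (Ψ : QReg n → ℂ), Ψ ∈ stabilizerStates n ∧
      basisState x + Complex.I ^ m • basisState y = c • Ψ := by
  obtain ⟨c, Ψ, hΨ, h⟩ := StabilizerFormalism.exists_smul_stabilizer_of_pauliProj
    (basisState_mem_stabilizerStates x) m (StabilizerFormalism.bxor x y) (fun _ => false)
  refine ⟨c, Ψ, hΨ, ?_⟩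
  have hxy : StabilizerFormalism.bxor x (StabilizerFormalism.bxor x y) = y := by
    funext i
    simp only [StabilizerFormalism.bxor_apply]
    cases x i <;> cases y i <;> rfl
  rw [← h, Matrix.smul_mulVec, StabilizerFormalism.pauliOp_mulVec_basisState,
    StabilizerFormalism.sgn_zero_left, one_smul, hxy]

/-! ### Strassen's scheme: `k = 1` -/

/-- The bit-level `⟨2, 2, 2⟩` (wire `0` = row bit, wire `1` = column bit):
`[x₀ = y₀][y₁ = z₀][x₁ = z₁]`, i.e. `Z_{κν} ← X_{κμ} Y_{μν}` (Bläser 2013, §5). -/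
theorem matMulTensor_bits_one (x y z : QReg (1 + 1)) :
    matMulTensor ℂ (2 ^ 1) (2 ^ 1) (2 ^ 1) (bitSplitEquiv 1 x) (bitSplitEquiv 1 y)
        (bitSplitEquiv 1 z) = if x 0 = y 0 ∧ y 1 = z 0 ∧ x 1 = z 1 then 1 else 0 := by
  rw [matMulTensor_bitSplitEquiv]
  -- `castAdd 1 0 = 0` and `natAdd 1 0 = 1` on `Fin (1 + 1)`, definitionally
  exact if_congr (by simp only [Fin.forall_fin_one]; exact Iff.rfl) rfl rfl

/-- **Strassen's algorithm is a stabilizer scheme**: `χ₃(⟨2, 2, 2⟩) ≤ 7`. The seven products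
`M₁ = (A₁₁+A₂₂)(B₁₁+B₂₂)`, `M₂ = (A₂₁+A₂₂)B₁₁`, `M₃ = A₁₁(B₁₂-B₂₂)`, `M₄ = A₂₂(B₂₁-B₁₁)`,
`M₅ = (A₁₁+A₁₂)B₂₂`, `M₆ = (A₂₁-A₁₁)(B₁₁+B₁₂)`, `M₇ = (A₁₂-A₂₂)(B₂₁+B₂₂)` with
`C₁₁ = M₁+M₄-M₅+M₇`, `C₁₂ = M₃+M₅`, `C₂₁ = M₂+M₄`, `C₂₂ = M₁-M₂+M₃+M₆` (Strassen 1969) write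
`⟨2,2,2⟩` as seven triads whose `21` legs are `|x⟩` or `|x⟩ + i^m |y⟩` (`m ∈ {0, 2}`), scalar
multiples of `2`-qubit stabilizer states. Modulo `hasStabilizerScheme_iff` this is the route's
item `StrassenStabilizer`. -/
theorem hasStabilizerScheme_one : HasStabilizerScheme 1 7 := by
  -- the four basis labels of `𝔽₂²` (wire 0 = row bit, wire 1 = column bit) and the legs
  let ff : QReg (1 + 1) := ![false, false]
  let ft : QReg (1 + 1) := ![false, true]
  let tf : QReg (1 + 1) := ![true, false]
  let tt : QReg (1 + 1) := ![true, true]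
  let e : QReg (1 + 1) → QReg (1 + 1) → ℂ := basisState
  let q : QReg (1 + 1) → ℕ → QReg (1 + 1) → QReg (1 + 1) → ℂ := fun a m b =>
    basisState a + Complex.I ^ m • basisState b
  let W : Fin 7 → QReg (1 + 1) → ℂ :=
    ![q ff 0 tt, q tf 2 tt, q ft 0 tt, q ff 0 tf, q ft 2 ff, e tt, e ff]
  let U : Fin 7 → QReg (1 + 1) → ℂ :=
    ![q ff 0 tt, q tf 0 tt, e ff, e tt, q ff 0 ft, q tf 2 ff, q ft 2 tt]
  let V : Fin 7 → QReg (1 + 1) → ℂ :=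
    ![q ff 0 tt, e ff, q ft 2 tt, q tf 2 ff, e tt, q ff 0 ft, q tf 0 tt]
  have h7 : Fintype.card (Fin 7) = 7 := Fintype.card_fin 7
  rw [← h7]
  refine hasStabilizerScheme_of_scaled W U V ?_ ?_ ?_ ?_
  · intro s
    fin_cases s
    all_goals first
      | exact exists_smul_stabilizer_basisState_add _ _ _
      | exact exists_smul_stabilizer_basisState _
  · intro s
    fin_cases s
    all_goals first
      | exact exists_smul_stabilizer_basisState_add _ _ _
      | exact exists_smul_stabilizer_basisState _
  · intro s
    fin_cases s
    all_goals first
      | exact exists_smul_stabilizer_basisState_add _ _ _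
      | exact exists_smul_stabilizer_basisState _
  · funext x y z
    obtain ⟨x₀, x₁, rfl⟩ : ∃ a b : Bool, x = ![a, b] := ⟨x 0, x 1, by ext i; fin_cases i <;> rfl⟩
    obtain ⟨y₀, y₁, rfl⟩ : ∃ a b : Bool, y = ![a, b] := ⟨y 0, y 1, by ext i; fin_cases i <;> rfl⟩
    obtain ⟨z₀, z₁, rfl⟩ : ∃ a b : Bool, z = ![a, b] := ⟨z 0, z 1, by ext i; fin_cases i <;> rfl⟩
    rw [matMulTensor_bits_one]
    simp only [Finset.sum_apply, triad_apply, Fin.sum_univ_seven, W, U, V, q, e, ff, ft, tf, tt,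
      Matrix.cons_val, Matrix.cons_val_zero, Matrix.cons_val_one, Pi.add_apply, Pi.smul_apply,
      smul_eq_mul, basisState_apply, Matrix.vecCons_inj, and_true, pow_zero, Complex.I_sq,
      one_mul]
    cases x₀ <;> cases x₁ <;> cases y₀ <;> cases y₁ <;> cases z₀ <;> cases z₁ <;> norm_num

/-! ### Induction on `k` and the item -/

/-- `χ₃(⟨1, 1, 1⟩) ≤ 1`: the standard algorithm at `k = 0` (one matrix-unit triad, whose legs
read as the `0`-qubit vacuum). -/
theorem hasStabilizerScheme_zero : HasStabilizerScheme 0 1 := by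
  simpa using hasStabilizerScheme_standard 0

/-- **The upper frame `ω_stab ≤ log₂ 7`**: `χ₃(⟨2^k, 2^k, 2^k⟩) ≤ 7^k` for every `k`, by
induction — Strassen at each step, composed by the Kronecker closure of the model
(`hasStabilizerScheme_mul`, Theorems/StabilizerTensorRankStabKronecker).
[Strassen 1969; Bläser 2013, §5] -/
theorem hasStabilizerScheme_seven_pow (k : ℕ) : HasStabilizerScheme k (7 ^ k) := by
  induction k with
  | zero => simpa using hasStabilizerScheme_zero
  | succ k ih =>
    rw [pow_succ]
    exact hasStabilizerScheme_mul ih hasStabilizerScheme_one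

end StrassenPowerFrame

/-- Settles item `stmt-MatrixMultiplication-3834` (`StrassenPowerFrame`) of route
MatrixMultiplication/StabilizerTensorRank: for every `k`, `⟨2^k, 2^k, 2^k⟩` has a stabilizer
scheme with `7^k` terms. [Strassen 1969; Bläser 2013, §5] -/
theorem strassenPowerFrame_proof :
    Summit.MatrixMultiplication.MatrixMultiplication.Theses.StabilizerTensorRank.StrassenPowerFrame :=
  fun k => (hasStabilizerScheme_iff k (7 ^ k)).mp
    (StrassenPowerFrame.hasStabilizerScheme_seven_pow k)

end Summit.MatrixMultiplication.MatrixMultiplication.Theorems
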